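import Literature.NumberTheory.K2Lit.DoublingEmbedding                    -- ★ `iotaLeft`, `continuous_iotaLeft` (p854744)
import Literature.NumberTheory.K2Lit.SiegelEisensteinSeriesDoubled         -- ★ `siegelDeltaCharacter`, `IsSiegelDeltaSection`, `modDelta_pos` (p854694)
import Literature.NumberTheory.Automorphic.GLOneOfHeckeCharacterBJ         -- ★ `HeckeCharacter.exists_norm_apply_eq_ideleNorm_rpow` (`|χ| = ‖·‖^σ`)
import Mathlib.Analysis.SpecialFunctions.Pow.Complex
import Mathlib.Analysis.SpecialFunctions.Pow.Real
import Mathlib.Analysis.Normed.Group.Bounded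
import Mathlib.MeasureTheory.Function.L1Space.Integrable
import HarnessLib

/-!
# Crux `HLiu418`, Track B road `K2_Liu`, unit U5 «DOUBLING ZETA», file #14a — helper:
# the REDUCTION of «a continuous Siegel section is `L¹` along `g ↦ ι(g, 1)`» to the doubling decay of a `P_Δ`-height

Cell `hodgecm-mathlib`, crux item hLiu418 = `stmt-HodgeConjecture-24832`, route of record `HCCMUnconditional`; squad K2 ∕ K2Liu,
LEAD F0P6-plan (g10) «SKELETON LANDED K2Liu №3» (K2/STATUS 21:14:18Z, DEAL BY NAME: #14a ↦ K2Liu-p04), planner K2Liu-plan (g0),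
prover K2Liu-p04 (g0).  THEOREMS ONLY (no `def`, no instance, no notation, no named-fact hypothesis, no `sorry`); lane
`--supports stmt-HodgeConjecture-24832 --as helper` (count-neutral helper toward socket #14a `sig_K2LiuDoublingSectionIntegrable` of
`Cruxes/HLiu418/Lines/K2_Liu_CurveThetaSigs_U5_DoublingZeta.lean`; the socket is NOT proved in this file).

THE SOCKET (#14a, frozen): for the doubled group `H(𝔸) = U(𝕍 ⊕ −𝕍)(𝔸)` of the CM datum (`𝕍 = V ⊗ W`), ANY Hecke character `χ`,
there is `σ₀` with: `Re s > σ₀`, `f` a CONTINUOUS Siegel section of `I(s, χ)` ⇒ `g ↦ f(ι(g, 1))` is `ν`-integrable on `U(V)(𝔸)` for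
every Haar `ν` ([Liu2021, Lem. B.10 (2) p. 102]; [PSR87, Part A §1]).  Its proof has three organs:
(I) an Iwasawa decomposition `H(𝔸) = P_Δ(𝔸) · K`, `K` compact — ★ `K2LiuSiegelDoubledIwasawaCompact.exists_isCompact_isSiegelDelta_mul`
(K2Liu-p09, p-landed; needs `dV i ≠ 0`, `dW i ≠ 0`); (II) domination of a continuous section by a power of a height of type
`(P_Δ, |det_Δ|^{1∕2})`; (IV) the DOUBLING DECAY: integrability over `U(V)(𝔸)` of that height power along `ι(·, 1)` (the XL analytic
engine — PSR's «`Δ(g)` decays», local Cartan decompositions at every place and an Euler product; NOT in the tree).  THIS FILE proves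
(II) for an ARBITRARY (not necessarily unitary) Hecke character and the composition «(I) ∧ (IV) ⇒ #14a» with (I), (IV) as data-level
hypotheses, ending in a statement of the socket's exact logical shape (`∃ σ₀, ∀ s, σ₀ < Re s → …`):

* §1 `ideleNorm_nonneg'`, `norm_chiDet_eq_modDelta_rpow` — if `|χ| = ‖·‖^σ` (★ `exists_norm_apply_eq_ideleNorm_rpow`, Weil VII §3)
  then `‖χ(det_Δ p)‖ = modDelta(p)^{2σ}` (★ `modDelta p = |det_Δ p|^{1∕2}`, value `1` off units on both sides);
  `norm_siegelDeltaCharacter_rpow` — `‖χ(det_Δ p)|det_Δ p|^{s+n∕2}‖ = modDelta(p)^{2(Re s + σ) + n}` (generalises K2Liu-p09's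
  unitary `norm_siegelDeltaCharacter`, `σ = 0`);
* §2 `norm_apply_siegelDelta_mul_rpow`, `norm_apply_le_of_decomp_rpow` — `‖f(p h)‖ = modDelta(p)^τ ‖f h‖` and the pointwise domination
  `‖f x‖ ≤ (B ∕ c^τ) · Φ(x)^τ` for `x = p k`, `‖f‖ ≤ B` on `K`, `Φ` of type `(P_Δ, modDelta)` with `Φ ≥ c > 0` on `K`, `τ = 2(Re s + σ) + n ≥ 0`;
* §3 **`integrable_comp_iotaLeft_of_decomp_of_decay`** — (I) + (IV at the exponent `τ`) ⇒ `Integrable (f ∘ iotaLeft) ν`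
  (`Integrable.mono'`, continuity of `f ∘ ι(·,1)` from ★ `continuous_iotaLeft`);
* §4 **`exists_threshold_integrable_comp_iotaLeft`** — the socket's SHAPE: from (I) and (IV) «`Φ(ι(g,1))^τ ∈ L¹(ν)` for all
  `τ ≥ τ₁` and all Haar `ν`» one gets `∃ σ₀, ∀ s, σ₀ < Re s → ∀ f` continuous Siegel section of `I(s, χ)`, `∀ ν` Haar,
  `Integrable (f ∘ iotaLeft) ν`, with `σ₀ = (max τ₁ 0 − n)∕2 − σ` («depending on the datum and on `χ`», as the socket says).

HONEST LABEL.  Count-neutral helper; it retires nothing by itself.  What #14a still needs is organ (IV) (XL; twin of K2Liu-p09's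
Godement count (III) for #9) and, for degenerate data, a decision on the missing `dV i ≠ 0 ∕ dW 0 ≠ 0` binders of the socket (organ (I)
★ is stated under them).  `HC_CM` is proved only modulo the 7 printed citations (2 remaining named inputs: hLiu418 =
`stmt-HodgeConjecture-24832`, h413 = `stmt-HodgeConjecture-24833`) until rung 0 closes.

## References
* [Liu2021] Y. Liu, *Fourier–Jacobi cycles and arithmetic relative trace formula*, Camb. J. Math. 9 (2021): App. B, Lem. B.10 (2) p. 102.
* [GelbartPiatetskishapiroRallis1987] I. Piatetski-Shapiro, S. Rallis, *L-functions for the classical groups* (Part A of LNM 1254), §1.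
* [WeilBNT1967] A. Weil, *Basic Number Theory*, Ch. VII §3 (quasi-characters: `|ω| = ω_σ`).
* [Garrett2018] P. Garrett, *Modern Analysis of Automorphic Forms by Example* (2018), §3.10 (domination by the spherical height).
-/

set_option autoImplicit false
-- the mandated namespace repeats the single-problem summit's segment (`HodgeConjecture.HodgeConjecture`)
set_option linter.dupNamespace false

noncomputable section

open scoped Matrix
open NumberField IsDedekindDomain MeasureTheory

namespace Summit.HodgeConjecture.HodgeConjecture.Cruxes.HLiu418.K2LiuDoublingSectionIntegrableReduction

open Literature.NumberTheory.Automorphic Literature.NumberTheory.GaloisRepresentations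
open Literature.NumberTheory.GelbartRogawski1991 Literature.NumberTheory.GelbartRogawski1991.GRConstruction
open Literature.NumberTheory.K2Lit.SiegelDoubled

variable (L : Type) [Field L] [NumberField L] [IsCMField L]
variable {N M n : ℕ} (e : Fin N × Fin M ≃ Fin n)
  (dV : Fin N → L) (hdV : ∀ i, IsCMField.complexConj L (dV i) = dV i)
  (dW : Fin M → L) (hdW : ∀ i, IsCMField.complexConj L (dW i) = dW i)

/-! ## §1 The norm of the inducing character for an ARBITRARY Hecke character (`|χ| = ‖·‖^σ`) -/

omit [IsCMField L] in
/-- The idele norm is non-negative (a product of norms). [cite: TateThesis1967, §4.3] -/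
theorem ideleNorm_nonneg' (x : ideleGroup L) : 0 ≤ ideleNorm x := by
  unfold ideleNorm
  exact mul_nonneg (Finset.prod_nonneg fun _ _ => pow_nonneg (norm_nonneg _) _) (finprod_nonneg fun _ => norm_nonneg _)

/-- **`‖χ(det_Δ p)‖ = modDelta(p)^{2σ}`** when `|χ| = ‖·‖^σ` on ideles (★ `chiDet χ p = χ(det_Δ p)` at the unit `det_Δ p`,
★ `modDelta p = |det_Δ p|_{𝔸_L}^{1∕2}`; both are `1` off units). [cite: WeilBNT1967, Ch. VII §3] [cite: Liu2021, §B.3 p. 101] -/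
theorem norm_chiDet_eq_modDelta_rpow (χ : HeckeCharacter L) {σ : ℝ}
    (hσ : ∀ x : ideleGroup L, ‖((χ x : ℂˣ) : ℂ)‖ = ideleNorm x ^ σ) (p : HA L e dV hdV dW hdW) :
    ‖((chiDet L e dV hdV dW hdW χ p : ℂˣ) : ℂ)‖ = modDelta L e dV hdV dW hdW p ^ (2 * σ) := by
  unfold chiDet modDelta
  split_ifs with hu
  · rw [hσ, Real.rpow_mul (Real.sqrt_nonneg _), Real.rpow_two, Real.sq_sqrt (ideleNorm_nonneg' L _)]
  · simp

/-- **`‖χ(det_Δ p) · |det_Δ p|^{s + n∕2}‖ = modDelta(p)^{2(Re s + σ) + n}`** when `|χ| = ‖·‖^σ` (principal complex power of the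
positive real ★ `modDelta p`). [cite: WeilBNT1967, Ch. VII §3] [cite: Liu2021, Lem. B.10 (2) p. 102] -/
theorem norm_siegelDeltaCharacter_rpow (χ : HeckeCharacter L) {σ : ℝ}
    (hσ : ∀ x : ideleGroup L, ‖((χ x : ℂˣ) : ℂ)‖ = ideleNorm x ^ σ) (s : ℂ) (p : HA L e dV hdV dW hdW) :
    ‖siegelDeltaCharacter L e dV hdV dW hdW χ s p‖ =
      modDelta L e dV hdV dW hdW p ^ (2 * (s.re + σ) + (n : ℝ)) := by
  unfold siegelDeltaCharacter
  rw [norm_mul, norm_chiDet_eq_modDelta_rpow L e dV hdV dW hdW χ hσ p,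
    Complex.norm_cpow_eq_rpow_re_of_pos (modDelta_pos L e dV hdV dW hdW p),
    ← Real.rpow_add (modDelta_pos L e dV hdV dW hdW p)]
  congr 1
  simp only [Complex.add_re, Complex.mul_re, Complex.re_ofNat, Complex.im_ofNat, Complex.natCast_re, zero_mul,
    sub_zero]
  ring

/-! ## §2 Sections: the norm along `P_Δ(𝔸)` and the pointwise domination by a height power -/

/-- **`‖f(p h)‖ = modDelta(p)^{2(Re s + σ) + n} · ‖f(h)‖`** for a Siegel section `f` of `I(s, χ)`, `|χ| = ‖·‖^σ`, `p ∈ P_Δ(𝔸)`.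
[cite: Liu2021, Lem. B.10 (2) p. 102] [cite: Garrett2018, §3.10] -/
theorem norm_apply_siegelDelta_mul_rpow (χ : HeckeCharacter L) {σ : ℝ}
    (hσ : ∀ x : ideleGroup L, ‖((χ x : ℂˣ) : ℂ)‖ = ideleNorm x ^ σ) {s : ℂ} {f : HA L e dV hdV dW hdW → ℂ}
    (hf : IsSiegelDeltaSection L e dV hdV dW hdW χ s f) {p : HA L e dV hdV dW hdW}
    (hp : IsSiegelDelta L e dV hdV dW hdW p) (h : HA L e dV hdV dW hdW) :
    ‖f (p * h)‖ = modDelta L e dV hdV dW hdW p ^ (2 * (s.re + σ) + (n : ℝ)) * ‖f h‖ := by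
  rw [hf p hp h, norm_mul, norm_siegelDeltaCharacter_rpow L e dV hdV dW hdW χ hσ s p]

/-- **Pointwise domination.**  If `x = p · k` with `p ∈ P_Δ(𝔸)`, `k ∈ K`, `‖f‖ ≤ B` on `K`, `Φ` a height of type `(P_Δ, modDelta)`
(`Φ(p y) = modDelta(p) Φ(y)`) with `Φ ≥ c > 0` on `K`, and `τ = 2(Re s + σ) + n ≥ 0`, then `‖f x‖ ≤ (B ∕ c^τ) · Φ(x)^τ`.
[cite: Garrett2018, §3.10] [cite: Liu2021, Lem. B.10 (2) p. 102] -/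
theorem norm_apply_le_of_decomp_rpow (χ : HeckeCharacter L) {σ : ℝ}
    (hσ : ∀ x : ideleGroup L, ‖((χ x : ℂˣ) : ℂ)‖ = ideleNorm x ^ σ) {s : ℂ} (hτ : 0 ≤ 2 * (s.re + σ) + (n : ℝ))
    {f : HA L e dV hdV dW hdW → ℂ} (hf : IsSiegelDeltaSection L e dV hdV dW hdW χ s f)
    {K : Set (HA L e dV hdV dW hdW)} {B : ℝ} (hB : ∀ k ∈ K, ‖f k‖ ≤ B)
    {Φ : HA L e dV hdV dW hdW → ℝ} (hΦpos : ∀ x, 0 < Φ x)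
    (hΦ : ∀ p x, IsSiegelDelta L e dV hdV dW hdW p → Φ (p * x) = modDelta L e dV hdV dW hdW p * Φ x)
    {c : ℝ} (hc : 0 < c) (hcK : ∀ k ∈ K, c ≤ Φ k)
    {x p k : HA L e dV hdV dW hdW} (hp : IsSiegelDelta L e dV hdV dW hdW p) (hk : k ∈ K) (hx : x = p * k) :
    ‖f x‖ ≤ B / c ^ (2 * (s.re + σ) + (n : ℝ)) * Φ x ^ (2 * (s.re + σ) + (n : ℝ)) := by
  set τ : ℝ := 2 * (s.re + σ) + (n : ℝ) with hτdef
  have hmod : 0 < modDelta L e dV hdV dW hdW p := modDelta_pos L e dV hdV dW hdW p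
  have hΦx : Φ x = modDelta L e dV hdV dW hdW p * Φ k := by rw [hx]; exact hΦ p k hp
  have hmod_le : modDelta L e dV hdV dW hdW p ≤ Φ x / c := by
    rw [le_div_iff₀ hc, hΦx]
    exact mul_le_mul_of_nonneg_left (hcK k hk) hmod.le
  have hpow_le : modDelta L e dV hdV dW hdW p ^ τ ≤ (Φ x / c) ^ τ := Real.rpow_le_rpow hmod.le hmod_le hτ
  calc ‖f x‖ = modDelta L e dV hdV dW hdW p ^ τ * ‖f k‖ := by
        rw [hx]; exact norm_apply_siegelDelta_mul_rpow L e dV hdV dW hdW χ hσ hf hp k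
    _ ≤ (Φ x / c) ^ τ * B :=
        mul_le_mul hpow_le (hB k hk) (norm_nonneg _) (Real.rpow_nonneg (div_nonneg (hΦpos x).le hc.le) τ)
    _ = B / c ^ τ * Φ x ^ τ := by
        rw [Real.div_rpow (hΦpos x).le hc.le]
        ring

/-! ## §3 The reduction: (I) Iwasawa–compact ∧ (IV) doubling decay of the height ⇒ `f ∘ ι(·, 1) ∈ L¹(ν)` -/

/-- **THE REDUCTION «(I) ∧ (IV) ⇒ socket #14a at the exponent `τ = 2(Re s + σ) + n ≥ 0`».**  Let `|χ| = ‖·‖^σ`, `f` a CONTINUOUS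
Siegel section of `I(s, χ)` on `H(𝔸) = U(𝕍 ⊕ −𝕍)(𝔸)`; (I) every `x ∈ H(𝔸)` is `p · k` with `p ∈ P_Δ(𝔸)`, `k ∈ K` compact; `Φ > 0` a
height of type `(P_Δ, modDelta)` with `Φ ≥ c > 0` on `K`; (IV) `g ↦ Φ(ι(g, 1))^τ` is `ν`-integrable on `U(V)(𝔸)`.  Then
`g ↦ f(ι(g, 1))` is `ν`-integrable (domination §2 + continuity of `f ∘ ι(·,1)`, ★ `continuous_iotaLeft`).
[cite: Liu2021, Lem. B.10 (2) p. 102] [cite: GelbartPiatetskishapiroRallis1987, Part A §1] -/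
theorem integrable_comp_iotaLeft_of_decomp_of_decay (χ : HeckeCharacter L) {σ : ℝ}
    (hσ : ∀ x : ideleGroup L, ‖((χ x : ℂˣ) : ℂ)‖ = ideleNorm x ^ σ) {s : ℂ} (hτ : 0 ≤ 2 * (s.re + σ) + (n : ℝ))
    {f : HA L e dV hdV dW hdW → ℂ} (hf : IsSiegelDeltaSection L e dV hdV dW hdW χ s f) (hfc : Continuous f)
    {K : Set (HA L e dV hdV dW hdW)} (hK : IsCompact K)
    (hPK : ∀ x : HA L e dV hdV dW hdW, ∃ p k : HA L e dV hdV dW hdW,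
      IsSiegelDelta L e dV hdV dW hdW p ∧ k ∈ K ∧ x = p * k)
    {Φ : HA L e dV hdV dW hdW → ℝ} (hΦpos : ∀ x, 0 < Φ x)
    (hΦ : ∀ p x, IsSiegelDelta L e dV hdV dW hdW p → Φ (p * x) = modDelta L e dV hdV dW hdW p * Φ x)
    {c : ℝ} (hc : 0 < c) (hcK : ∀ k ∈ K, c ≤ Φ k)
    [MeasurableSpace (UnitaryGroup.adelic (Fp L) L (IsCMField.complexConj L) N (Matrix.diagonal dV))]
    [BorelSpace (UnitaryGroup.adelic (Fp L) L (IsCMField.complexConj L) N (Matrix.diagonal dV))]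
    (ν : Measure (UnitaryGroup.adelic (Fp L) L (IsCMField.complexConj L) N (Matrix.diagonal dV)))
    (hdecay : Integrable (fun g => Φ (iotaLeft L e dV hdV dW hdW g) ^ (2 * (s.re + σ) + (n : ℝ))) ν) :
    Integrable (fun g => f (iotaLeft L e dV hdV dW hdW g)) ν := by
  obtain ⟨B, hB⟩ := hK.exists_bound_of_continuousOn hfc.continuousOn
  refine Integrable.mono' (hdecay.const_mul (B / c ^ (2 * (s.re + σ) + (n : ℝ))))
    ((hfc.comp (continuous_iotaLeft L e dV hdV dW hdW)).aestronglyMeasurable) (Filter.Eventually.of_forall fun g => ?_)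
  obtain ⟨p, k, hp, hk, hx⟩ := hPK (iotaLeft L e dV hdV dW hdW g)
  exact norm_apply_le_of_decomp_rpow L e dV hdV dW hdW χ hσ hτ hf hB hΦpos hΦ hc hcK hp hk hx

/-! ## §4 The socket's shape: `∃ σ₀` from (I) and the decay organ (IV) above a threshold `τ₁` -/

/-- **«(I) ∧ (IV) ⇒ the SHAPE of socket #14a».**  Given (I) an Iwasawa decomposition `H(𝔸) = P_Δ(𝔸) · K` (`K` compact), a height
`Φ > 0` of type `(P_Δ, modDelta)` with `Φ ≥ c > 0` on `K`, and (IV) a threshold `τ₁` such that `g ↦ Φ(ι(g,1))^τ` is integrable for every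
`τ ≥ τ₁` and every Haar measure `ν` on `U(V)(𝔸)`: for EVERY Hecke character `χ` there is `σ₀` (namely `(max τ₁ 0 − n)∕2 − σ` with
`|χ| = ‖·‖^σ`, ★ `HeckeCharacter.exists_norm_apply_eq_ideleNorm_rpow`) such that for `Re s > σ₀` every continuous Siegel section of
`I(s, χ)` is integrable along `g ↦ ι(g, 1)` for every Haar `ν` — literally the conclusion of `sig_K2LiuDoublingSectionIntegrable`.
[cite: Liu2021, Lem. B.10 (2) p. 102] [cite: GelbartPiatetskishapiroRallis1987, Part A §1] [cite: WeilBNT1967, Ch. VII §3] -/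
theorem exists_threshold_integrable_comp_iotaLeft (χ : HeckeCharacter L)
    {K : Set (HA L e dV hdV dW hdW)} (hK : IsCompact K)
    (hPK : ∀ x : HA L e dV hdV dW hdW, ∃ p k : HA L e dV hdV dW hdW,
      IsSiegelDelta L e dV hdV dW hdW p ∧ k ∈ K ∧ x = p * k)
    {Φ : HA L e dV hdV dW hdW → ℝ} (hΦpos : ∀ x, 0 < Φ x)
    (hΦ : ∀ p x, IsSiegelDelta L e dV hdV dW hdW p → Φ (p * x) = modDelta L e dV hdV dW hdW p * Φ x)
    {c : ℝ} (hc : 0 < c) (hcK : ∀ k ∈ K, c ≤ Φ k) {τ₁ : ℝ}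
    (hdecay : ∀ τ : ℝ, τ₁ ≤ τ →
      ∀ [MeasurableSpace (UnitaryGroup.adelic (Fp L) L (IsCMField.complexConj L) N (Matrix.diagonal dV))]
        [BorelSpace (UnitaryGroup.adelic (Fp L) L (IsCMField.complexConj L) N (Matrix.diagonal dV))]
        (ν : Measure (UnitaryGroup.adelic (Fp L) L (IsCMField.complexConj L) N (Matrix.diagonal dV)))
        [ν.IsHaarMeasure],
        Integrable (fun g => Φ (iotaLeft L e dV hdV dW hdW g) ^ τ) ν) :
    ∃ σ₀ : ℝ, ∀ (s : ℂ), σ₀ < s.re →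
      ∀ (f : HA L e dV hdV dW hdW → ℂ), IsSiegelDeltaSection L e dV hdV dW hdW χ s f → Continuous f →
        ∀ [MeasurableSpace (UnitaryGroup.adelic (Fp L) L (IsCMField.complexConj L) N (Matrix.diagonal dV))]
          [BorelSpace (UnitaryGroup.adelic (Fp L) L (IsCMField.complexConj L) N (Matrix.diagonal dV))]
          (ν : Measure (UnitaryGroup.adelic (Fp L) L (IsCMField.complexConj L) N (Matrix.diagonal dV)))
          [ν.IsHaarMeasure],
          Integrable (fun g => f (iotaLeft L e dV hdV dW hdW g)) ν := by
  obtain ⟨σ, hσ⟩ := χ.exists_norm_apply_eq_ideleNorm_rpow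
  refine ⟨(max τ₁ 0 - (n : ℝ)) / 2 - σ, fun s hs f hf hfc _ _ ν _ => ?_⟩
  have hτ₁ : τ₁ ≤ 2 * (s.re + σ) + (n : ℝ) := by
    have := le_max_left τ₁ 0
    linarith
  have hτ0 : 0 ≤ 2 * (s.re + σ) + (n : ℝ) := by
    have := le_max_right τ₁ 0
    linarith
  exact integrable_comp_iotaLeft_of_decomp_of_decay L e dV hdV dW hdW χ hσ hτ0 hf hfc hK hPK hΦpos hΦ hc hcK ν
    (hdecay _ hτ₁ ν)

end Summit.HodgeConjecture.HodgeConjecture.Cruxes.HLiu418.K2LiuDoublingSectionIntegrableReduction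

end
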